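import Mathlib.Algebra.Group.Hom.Defs
import Mathlib.Algebra.Group.Basic
import HarnessLib

/-!
# Inverse systems of abelian groups: the four lemma, and two properties stable under extensions

Carrier-free bookkeeping for `ℕ`-indexed inverse systems
`⋯ → B (N+1) —tB N→ B N → ⋯ → B 0` of abelian groups, given as EXPLICIT DATA
`(B : ℕ → Type*) [∀ N, AddCommGroup (B N)]`, `tB : ∀ N, B (N + 1) →+ B N` (no bundled
structure, no limit object). Two properties of such a system are tracked:

* **(S) surjective transitions**: `∀ N, Function.Surjective (tB N)`;
* **(T) compatible families killed by a non-zero integer vanish** — written out INLINE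
  wherever it occurs, as
  `∀ (L : ℤ), L ≠ 0 → ∀ x : (∀ N, B N), (∀ N, tB N (x (N + 1)) = x N) →`
  `(∀ N, L • x N = 0) → ∀ N, x N = 0`
  (equivalently: the inverse limit `lim_N B N` is a torsion-free abelian group; we never form
  the limit).

Results (all elementary diagram chases, all proved, no named facts):

* `surjective_of_four` — the **four lemma, surjectivity half**, for a map of three-term rows
  `A₁ → B₁ → C₁` over `A₂ → B₂ → C₂` with the weakest hypotheses the chase uses:
  `B₁ → C₁` onto, `ker (B₂ → C₂) ⊆ im (A₂ → B₂)`, outer vertical maps onto ⇒ middle vertical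
  map onto; `eq_zero_of_zsmul_eq_zero_of_extension` — its companion for (T) at one level (an
  extension of groups without `L`-torsion has no `L`-torsion).
* `transition_surjective_of_extension` — (S) passes through extensions of systems
  (`0 → A → B → C → 0` levelwise short exact, or just: `g (N+1)` onto and
  `ker g N ⊆ im f N`): (S) for `A` and `C` ⇒ (S) for `B` (the four lemma levelwise);
  `transition_surjective_of_surjective` — (S) descends along levelwise surjections of systems;
  `surjective_comp_transition`, `exists_compatible_family_of_surjective` — under (S) the
  two-step transitions are onto and every element of every level extends to a compatible
  family through ALL levels (the def-free form of "all composite transitions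
  `B (N + k) → B N` are onto").
* `torsionFamily_eq_zero_of_extension` — (T) passes through extensions of systems with `f N`
  injective and `ker g N ⊆ im f N`: (T) for `A` and `C` ⇒ (T) for `B`;
  `torsionFamily_eq_zero_of_injective` — (T) descends along levelwise injections of systems;
  `torsionFamily_eq_zero_of_subsingleton` — the zero system has (T). The first two are the
  `∀ L ≠ 0` wrappers of `family_eq_zero_of_zsmul_eq_zero_of_extension` /
  `family_eq_zero_of_zsmul_eq_zero_of_injective`, which treat ONE integer `L` (any `L`, the
  hypothesis `L ≠ 0` is never used by the chase) — the form to use when only, say,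
  `p`-power torsion is controlled.

## Why (where this is used)

In X. Hu's description of the relative `K₀` of the `p`-adic thickenings `X_N` of a smooth
projective scheme over `W(k)` by hypercohomology of truncated, `p`-twisted de Rham complexes
(arXiv:2507.12458, Cor. 10.5 (i) and Prop. 11.1 (i)), the kernel tower
`ker (K₀(X_{N+1}) → K₀(X_1))` and the obstruction groups are controlled by inverse systems
(in `N`) of hypercohomology groups which are finite ITERATED EXTENSIONS — via the stupid
filtration — of systems of the shape `H^b(𝒳, Ωʲ)/p^{e(N)}` with their reduction maps. For
those basic systems (S) and (T) are elementary (neighbouring files); the present file is the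
induction step carrying (S) ("transitions of `ℍ^{2r-1}` are onto") and (T) ("compatible
families in `ℍ^{2r}` killed by an integer vanish") through the extensions.

## What is NOT here

No inverse limit object (see `Literature.Algebra.InverseSystem.addInverseLimit` for `lim` as a
subgroup of `Π N, B N`; property (T) is torsion-freeness of that subgroup, unfolded), no
`lim¹`, no Mittag-Leffler condition, no abelian categories / `Function.Exact` packaging.
Mathlib has the four lemma for rows of length four
(`AddMonoidHom.surjective_of_surjective_of_surjective_of_injective`,
`Mathlib.Algebra.FiveLemma`), whose specialisation to three-term rows would demand the
superfluous hypotheses `g₂ ∘ f₂ = 0` and `g₂` onto; the ten-line chase below avoids them.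
-/

namespace Literature.Algebra.Homology

/-! ### One level: the four lemma and torsion in extensions -/

section OneLevel

variable {A₁ : Type*} {B₁ : Type*} {C₁ : Type*} {A₂ : Type*} {B₂ : Type*} {C₂ : Type*}
  [AddCommGroup A₁] [AddCommGroup B₁] [AddCommGroup C₁]
  [AddCommGroup A₂] [AddCommGroup B₂] [AddCommGroup C₂]

/-- **Four lemma (surjectivity in the middle).** Given a commutative diagram of abelian groups
```
A₁ --f₁--> B₁ --g₁--> C₁
|a         |b         |c
v          v          v
A₂ --f₂--> B₂ --g₂--> C₂
```
(`b ∘ f₁ = f₂ ∘ a`, `c ∘ g₁ = g₂ ∘ b`) with `g₁` surjective, `ker g₂ ⊆ im f₂`, and `a`, `c`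
surjective, the middle map `b` is surjective. (Chase: for `y ∈ B₂` pick `x₁ ∈ B₁` over a
`c`-lift of `g₂ y`; then `y - b x₁ ∈ ker g₂ = f₂ (A₂) = f₂ (a (A₁)) = b (f₁ (A₁))`.)
[folklore] -/
theorem surjective_of_four (f₁ : A₁ →+ B₁) (g₁ : B₁ →+ C₁) (f₂ : A₂ →+ B₂) (g₂ : B₂ →+ C₂)
    (a : A₁ →+ A₂) (b : B₁ →+ B₂) (c : C₁ →+ C₂)
    (hf : b.comp f₁ = f₂.comp a) (hg : c.comp g₁ = g₂.comp b)
    (hg₁ : Function.Surjective g₁) (hex : ∀ y : B₂, g₂ y = 0 → ∃ x : A₂, f₂ x = y)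
    (ha : Function.Surjective a) (hc : Function.Surjective c) :
    Function.Surjective b := by
  have hf' : ∀ x, b (f₁ x) = f₂ (a x) := fun x => DFunLike.congr_fun hf x
  have hg' : ∀ x, c (g₁ x) = g₂ (b x) := fun x => DFunLike.congr_fun hg x
  intro y
  obtain ⟨z₁, hz₁⟩ := hc (g₂ y)
  obtain ⟨x₁, rfl⟩ := hg₁ z₁
  obtain ⟨w₂, hw₂⟩ := hex (y - b x₁) (by rw [map_sub, ← hg' x₁, hz₁, sub_self])
  obtain ⟨w₁, rfl⟩ := ha w₂
  exact ⟨f₁ w₁ + x₁, by rw [map_add, hf' w₁, hw₂, sub_add_cancel]⟩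

/-- **No `L`-torsion in an extension.** If `f : A →+ B` is injective, `ker g ⊆ im f` for
`g : B →+ C`, and neither `A` nor `C` has non-zero elements killed by the integer `L`, then
neither has `B`. (Chase: `g (L • y) = 0` forces `g y = 0`, so `y = f x` with `f (L • x) = 0`,
so `x = 0`.) [folklore] -/
theorem eq_zero_of_zsmul_eq_zero_of_extension (f : A₂ →+ B₂) (g : B₂ →+ C₂)
    (hinj : Function.Injective f) (hex : ∀ y : B₂, g y = 0 → ∃ x : A₂, f x = y) (L : ℤ)
    (hA : ∀ x : A₂, L • x = 0 → x = 0) (hC : ∀ z : C₂, L • z = 0 → z = 0)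
    (y : B₂) (hy : L • y = 0) : y = 0 := by
  obtain ⟨x, rfl⟩ := hex y (hC (g y) (by rw [← map_zsmul, hy, map_zero]))
  rw [hA x (hinj (by rw [map_zsmul, hy, map_zero])), map_zero]

end OneLevel

/-! ### Systems: surjective transitions through extensions -/

section Systems

variable {A : ℕ → Type*} {B : ℕ → Type*} {C : ℕ → Type*}
  [∀ N, AddCommGroup (A N)] [∀ N, AddCommGroup (B N)] [∀ N, AddCommGroup (C N)]

/-- **Surjective transitions pass through extensions of inverse systems.** Let `A`, `B`, `C`
be inverse systems of abelian groups with transition maps `tA`, `tB`, `tC`, and let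
`f N : A N →+ B N`, `g N : B N →+ C N` be levelwise homomorphisms commuting with the
transitions, with every `g (N + 1)` surjective and `ker (g N) ⊆ im (f N)` for every `N`
(e.g. `0 → A → B → C → 0` levelwise short exact). If all transition maps of `A` and of `C`
are surjective, so are those of `B` (the four lemma `surjective_of_four` at each level).
[folklore] -/
theorem transition_surjective_of_extension
    (tA : ∀ N, A (N + 1) →+ A N) (tB : ∀ N, B (N + 1) →+ B N) (tC : ∀ N, C (N + 1) →+ C N)
    (f : ∀ N, A N →+ B N) (g : ∀ N, B N →+ C N)
    (hf : ∀ N, (tB N).comp (f (N + 1)) = (f N).comp (tA N))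
    (hg : ∀ N, (tC N).comp (g (N + 1)) = (g N).comp (tB N))
    (hsurj : ∀ N, Function.Surjective (g (N + 1)))
    (hex : ∀ N (y : B N), g N y = 0 → ∃ x : A N, f N x = y)
    (htA : ∀ N, Function.Surjective (tA N)) (htC : ∀ N, Function.Surjective (tC N)) :
    ∀ N, Function.Surjective (tB N) := fun N =>
  surjective_of_four (f (N + 1)) (g (N + 1)) (f N) (g N) (tA N) (tB N) (tC N) (hf N) (hg N)
    (hsurj N) (hex N) (htA N) (htC N)

/-- **Surjective transitions descend along surjections of inverse systems.** If
`π N : B N →+ B' N` are surjective homomorphisms commuting with the transitions and all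
transition maps of `B` are surjective, so are those of `B'`
(`tB' N ∘ π (N + 1) = π N ∘ tB N` is onto). [folklore] -/
theorem transition_surjective_of_surjective {B' : ℕ → Type*} [∀ N, AddCommGroup (B' N)]
    (tB : ∀ N, B (N + 1) →+ B N) (tB' : ∀ N, B' (N + 1) →+ B' N) (π : ∀ N, B N →+ B' N)
    (hπ : ∀ N, (tB' N).comp (π (N + 1)) = (π N).comp (tB N))
    (hsurj : ∀ N, Function.Surjective (π N)) (h : ∀ N, Function.Surjective (tB N)) :
    ∀ N, Function.Surjective (tB' N) := fun N y => by
  obtain ⟨x, rfl⟩ := hsurj N y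
  obtain ⟨x, rfl⟩ := h N x
  exact ⟨π (N + 1) x, DFunLike.congr_fun (hπ N) x⟩

/-- Two-step transitions of a system with surjective transitions are surjective. [folklore] -/
theorem surjective_comp_transition (tB : ∀ N, B (N + 1) →+ B N)
    (h : ∀ N, Function.Surjective (tB N)) (N : ℕ) :
    Function.Surjective ((tB N).comp (tB (N + 1))) :=
  (h N).comp (h (N + 1))

/-- Auxiliary form of `exists_compatible_family_of_surjective` with the level `N` first and the
system quantified afterwards, for the induction on `N` over the shifted system. [folklore] -/
private theorem exists_compatible_family_of_surjective_aux (N : ℕ) :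
    ∀ {B : ℕ → Type*} [∀ M, AddCommGroup (B M)] (tB : ∀ M, B (M + 1) →+ B M),
      (∀ M, Function.Surjective (tB M)) → ∀ y : B N,
      ∃ x : ∀ M, B M, (∀ M, tB M (x (M + 1)) = x M) ∧ x N = y := by
  induction N with
  | zero =>
    intro B _ tB h y
    -- climb the tower by chosen lifts
    let up : ∀ M, B M := fun M => Nat.rec (motive := fun M => B M) y
      (fun M z => Classical.choose (h M z)) M
    exact ⟨up, fun M => Classical.choose_spec (h M (up M)), rfl⟩
  | succ N ih =>
    intro B _ tB h y
    obtain ⟨x', hx', hN⟩ :=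
      ih (B := fun M => B (M + 1)) (fun M => tB (M + 1)) (fun M => h (M + 1)) y
    refine ⟨fun M => match M with
      | 0 => tB 0 (x' 0)
      | M + 1 => x' M, fun M => ?_, hN⟩
    match M with
    | 0 => rfl
    | M + 1 => exact hx' M

/-- **Compatible families through a given element.** If all transition maps of the inverse
system `B` are surjective, then every `y ∈ B N` is the `N`-th component of a compatible family
`x ∈ Π M, B M`, `tB M (x (M + 1)) = x M` for all `M` (so `y` lifts to every higher level,
compatibly: the def-free form of "all composite transitions `B (N + k) → B N` are onto", i.e.
`lim_M B M → B N` is onto). Below `N` the family is forced; above `N` it is built by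
successive choices. [folklore] -/
theorem exists_compatible_family_of_surjective (tB : ∀ N, B (N + 1) →+ B N)
    (h : ∀ N, Function.Surjective (tB N)) (N : ℕ) (y : B N) :
    ∃ x : ∀ M, B M, (∀ M, tB M (x (M + 1)) = x M) ∧ x N = y :=
  exists_compatible_family_of_surjective_aux N tB h y

/-! ### Systems: vanishing of torsion compatible families through extensions -/

/-- **Compatible families killed by `L` vanish in an extension if they do in the outer terms**
(one integer `L` at a time). Let `A`, `B`, `C` be inverse systems of abelian groups with
transitions `tA`, `tB`, `tC` and levelwise homomorphisms `f N : A N →+ B N`,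
`g N : B N →+ C N` commuting with the transitions, with every `f N` injective and
`ker (g N) ⊆ im (f N)`. If every compatible family of `A`, resp. of `C`, killed by `L` is
zero, then so is every compatible family `x` of `B` killed by `L`. (Chase: the family `g x` is
compatible and killed by `L`, hence zero; so `x N = f N (a N)`, and the `a N` are compatible
and killed by `L` because `f N` is injective; hence `a = 0` and `x = 0`.) [folklore] -/
theorem family_eq_zero_of_zsmul_eq_zero_of_extension
    (tA : ∀ N, A (N + 1) →+ A N) (tB : ∀ N, B (N + 1) →+ B N) (tC : ∀ N, C (N + 1) →+ C N)
    (f : ∀ N, A N →+ B N) (g : ∀ N, B N →+ C N)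
    (hf : ∀ N, (tB N).comp (f (N + 1)) = (f N).comp (tA N))
    (hg : ∀ N, (tC N).comp (g (N + 1)) = (g N).comp (tB N))
    (hinj : ∀ N, Function.Injective (f N))
    (hex : ∀ N (y : B N), g N y = 0 → ∃ x : A N, f N x = y) (L : ℤ)
    (hA : ∀ x : (∀ N, A N), (∀ N, tA N (x (N + 1)) = x N) → (∀ N, L • x N = 0) →
      ∀ N, x N = 0)
    (hC : ∀ x : (∀ N, C N), (∀ N, tC N (x (N + 1)) = x N) → (∀ N, L • x N = 0) →
      ∀ N, x N = 0)
    (x : ∀ N, B N) (hx : ∀ N, tB N (x (N + 1)) = x N) (hLx : ∀ N, L • x N = 0) :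
    ∀ N, x N = 0 := by
  have hf' : ∀ N z, tB N (f (N + 1) z) = f N (tA N z) := fun N z =>
    DFunLike.congr_fun (hf N) z
  have hg' : ∀ N z, tC N (g (N + 1) z) = g N (tB N z) := fun N z =>
    DFunLike.congr_fun (hg N) z
  -- the image family in `C` is compatible and killed by `L`, hence zero
  have hgx : ∀ N, g N (x N) = 0 :=
    hC (fun N => g N (x N)) (fun N => by rw [hg' N, hx N])
      (fun N => by rw [← map_zsmul, hLx N, map_zero])
  -- lift to `A`; the lifts are compatible and killed by `L` since the `f N` are injective
  let a : ∀ N, A N := fun N => Classical.choose (hex N (x N) (hgx N))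
  have ha : ∀ N, f N (a N) = x N := fun N => Classical.choose_spec (hex N (x N) (hgx N))
  have hta : ∀ N, tA N (a (N + 1)) = a N := fun N =>
    hinj N (by rw [← hf' N, ha (N + 1), ha N, hx N])
  have hLa : ∀ N, L • a N = 0 := fun N =>
    hinj N (by rw [map_zsmul, ha N, hLx N, map_zero])
  intro N
  rw [← ha N, hA a hta hLa N, map_zero]

/-- **Torsion compatible families vanish in an extension if they do in the outer terms.** In
the situation of `family_eq_zero_of_zsmul_eq_zero_of_extension` (`f N` injective,
`ker (g N) ⊆ im (f N)`, everything commuting with the transitions): if every compatible family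
of `A`, resp. of `C`, killed by a non-zero integer is zero, then the same holds for `B`.
Equivalently: `0 → lim A → lim B → lim C` is exact and an extension of torsion-free abelian
groups is torsion-free — stated without limits. [folklore] -/
theorem torsionFamily_eq_zero_of_extension
    (tA : ∀ N, A (N + 1) →+ A N) (tB : ∀ N, B (N + 1) →+ B N) (tC : ∀ N, C (N + 1) →+ C N)
    (f : ∀ N, A N →+ B N) (g : ∀ N, B N →+ C N)
    (hf : ∀ N, (tB N).comp (f (N + 1)) = (f N).comp (tA N))
    (hg : ∀ N, (tC N).comp (g (N + 1)) = (g N).comp (tB N))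
    (hinj : ∀ N, Function.Injective (f N))
    (hex : ∀ N (y : B N), g N y = 0 → ∃ x : A N, f N x = y)
    (hA : ∀ (L : ℤ), L ≠ 0 → ∀ x : (∀ N, A N), (∀ N, tA N (x (N + 1)) = x N) →
      (∀ N, L • x N = 0) → ∀ N, x N = 0)
    (hC : ∀ (L : ℤ), L ≠ 0 → ∀ x : (∀ N, C N), (∀ N, tC N (x (N + 1)) = x N) →
      (∀ N, L • x N = 0) → ∀ N, x N = 0) :
    ∀ (L : ℤ), L ≠ 0 → ∀ x : (∀ N, B N), (∀ N, tB N (x (N + 1)) = x N) →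
      (∀ N, L • x N = 0) → ∀ N, x N = 0 :=
  fun L hL => family_eq_zero_of_zsmul_eq_zero_of_extension tA tB tC f g hf hg hinj hex L
    (hA L hL) (hC L hL)

/-- **Compatible families killed by `L`: descent along injections** (one integer `L` at a
time). If `ι N : B N →+ B' N` are injective homomorphisms of inverse systems commuting with
the transitions and every compatible family of `B'` killed by `L` vanishes, then so does
every compatible family of `B` killed by `L`. [folklore] -/
theorem family_eq_zero_of_zsmul_eq_zero_of_injective {B' : ℕ → Type*}
    [∀ N, AddCommGroup (B' N)]
    (tB : ∀ N, B (N + 1) →+ B N) (tB' : ∀ N, B' (N + 1) →+ B' N) (ι : ∀ N, B N →+ B' N)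
    (hι : ∀ N, (tB' N).comp (ι (N + 1)) = (ι N).comp (tB N))
    (hinj : ∀ N, Function.Injective (ι N)) (L : ℤ)
    (hB' : ∀ x : (∀ N, B' N), (∀ N, tB' N (x (N + 1)) = x N) → (∀ N, L • x N = 0) →
      ∀ N, x N = 0)
    (x : ∀ N, B N) (hx : ∀ N, tB N (x (N + 1)) = x N) (hLx : ∀ N, L • x N = 0) :
    ∀ N, x N = 0 := by
  intro N
  refine hinj N ?_
  rw [map_zero]
  exact hB' (fun N => ι N (x N)) (fun N => (DFunLike.congr_fun (hι N) (x (N + 1))).trans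
    (congrArg (ι N) (hx N))) (fun N => by rw [← map_zsmul, hLx N, map_zero]) N

/-- **Torsion compatible families: descent along injections.** If `ι N : B N →+ B' N` are
injective homomorphisms of inverse systems commuting with the transitions and every compatible
family of `B'` killed by a non-zero integer vanishes, then so does every such family of `B`.
[folklore] -/
theorem torsionFamily_eq_zero_of_injective {B' : ℕ → Type*} [∀ N, AddCommGroup (B' N)]
    (tB : ∀ N, B (N + 1) →+ B N) (tB' : ∀ N, B' (N + 1) →+ B' N) (ι : ∀ N, B N →+ B' N)
    (hι : ∀ N, (tB' N).comp (ι (N + 1)) = (ι N).comp (tB N))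
    (hinj : ∀ N, Function.Injective (ι N))
    (hB' : ∀ (L : ℤ), L ≠ 0 → ∀ x : (∀ N, B' N), (∀ N, tB' N (x (N + 1)) = x N) →
      (∀ N, L • x N = 0) → ∀ N, x N = 0) :
    ∀ (L : ℤ), L ≠ 0 → ∀ x : (∀ N, B N), (∀ N, tB N (x (N + 1)) = x N) →
      (∀ N, L • x N = 0) → ∀ N, x N = 0 :=
  fun L hL => family_eq_zero_of_zsmul_eq_zero_of_injective tB tB' ι hι hinj L (hB' L hL)

/-- **The zero system**: if every `B N` is trivial, compatible families killed by a non-zero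
integer (indeed all families) vanish. [folklore] -/
theorem torsionFamily_eq_zero_of_subsingleton (tB : ∀ N, B (N + 1) →+ B N)
    (hB : ∀ N, Subsingleton (B N)) :
    ∀ (L : ℤ), L ≠ 0 → ∀ x : (∀ N, B N), (∀ N, tB N (x (N + 1)) = x N) →
      (∀ N, L • x N = 0) → ∀ N, x N = 0 :=
  fun _ _ x _ _ N => (hB N).elim (x N) 0

end Systems

end Literature.Algebra.Homology
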